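import Literature.NumberTheory.PAdicHodge.AinfRamifiedTateModule
import Literature.NumberTheory.PAdicHodge.AinfRamifiedOmegaPeriodAdd
import Literature.NumberTheory.PAdicHodge.AinfRamifiedPeriodsBounded
import HarnessLib

/-!
# The ω-period `∫ω : T_pŴ♭(𝒪_{ℂ_F}) → B_dR⁺(F)` over the ramified base as a `ℤ_p`-linear `Γ_F`-equivariant homomorphism with
# values in `Fil¹`

Topic `Literature/NumberTheory/PAdicHodge`; namespace `Literature.NumberTheory.PAdicHodge.AinfRamTop`. The ramified twin of
`AinfWeierstrassTateModule` §3 (ω-part) + `AinfWeierstrassPeriodsLinear` §2 (ω-part): for `W` over the discrete copy `CoeffDisc D` of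
`𝒪_D = ℤ_p[ϖ]`, a bridge `ψ : 𝒪_D → 𝒪_F` compatible with `𝒪_D → F`, and `W♭ = W ⊗_ψ 𝒪_F`:

* **`omegaPeriodHomO W ψ hθ hψ : TatePtO F W♭ p →+ BdRPlusTop F p`, `τ ↦ ∫_τ ω = log_W(ι_𝒪[τ])`** — additive by
  `omegaPeriod_addSeq` (file `AinfRamifiedOmegaPeriodAdd`) read through `seqO_add_eq_addSeq` (file `AinfRamifiedTateModule`);
* `omegaPeriodHomO_apply` (`= omegaPeriodO`), **`omegaPeriodHomO_mem_filOne`**, **`gal_omegaPeriodHomO`** (`σ(∫_τ ω) = ∫_{σ•τ} ω`),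
  `omegaPeriodHomO_zsmul`;
* **`omegaPeriodHomO_smul : ∫_{a•τ} ω = ι(a)·∫_τ ω` for `a ∈ ℤ_p`** (boundedness `k!·∫ω ∈ ι_𝒪(A_inf(𝒪)) + Fil^k`,
  `AinfRamTop.omegaPeriod_bounded`, and `AinfRam.map_smul_eq_of_bounded`, file `AinfRamifiedPeriodsBounded`), and
  `omegaPeriodHomO_smul'` (scalar read through `ℚ_p → B_dR⁺`, the shape consumed by the socket `DeRhamOfTatePtOPeriods`);
* `omegaPeriodHomO_ne_zero_iff` bookkeeping: `∫_τ ω ≠ 0 ↔ omegaPeriod W hθ (seqO τ) … ≠ 0`.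

So `φ₁ := omegaPeriodHomO` discharges the hypotheses `hφ₁s`, `hφ₁g`, `hφ₁f` of `isDeRham_rationalTateRep_curveFO_of_periodHoms`; the
η-period (`φ₂`) is the sequel. BSD route EdixhovenFibreFiveSeven, crux K★ `stmt-BirchSwinnertonDyer-22226`, road (R1). BSD / K★ are
not proved by any of this.

## References
* J.-M. Fontaine, *Formes différentielles et modules de Tate…*, Invent. Math. 65 (1982), §5. [Fontaine1982FormesDifferentielles]
* J.-M. Fontaine, *Le corps des périodes p-adiques*, Astérisque 223 (1994), Exp. II §1.5.3–1.5.5. [FontaineAsterisque223III]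
* P. Colmez, *Périodes p-adiques des variétés abéliennes*, Math. Ann. 292 (1992), §2. [Colmez1992PeriodesAbeliennes]
-/

noncomputable section

open Ideal Filter Topology Field WittVector MvPowerSeries ValuativeRel

namespace Literature.NumberTheory.PAdicHodge

open Literature.NumberTheory.GaloisRepresentations
open Literature.NumberTheory.GaloisRepresentations.IsNonarchimedeanLocalField
open Literature.NumberTheory.GaloisRepresentations.LubinTate
open Literature.NumberTheory.EllipticCurves

namespace AinfRamTop

variable {F : Type} [Field F] [ValuativeRel F] [TopologicalSpace F] [IsNonarchimedeanLocalField F] [CharZero F]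
  {p : ℕ} [Fact p.Prime] [Fact (¬ IsUnit (p : integerC F))] [IsAdicComplete (Ideal.span {(p : integerC F)}) (integerC F)]
  {hp : valuation F p < 1} {D : EisensteinRoot F p hp}
  (W : WeierstrassCurve (EisensteinRoot.CoeffDisc D)) (ψ : EisensteinRoot.CoeffDisc D →+* LTCoeff F)
  {hθ : Function.Surjective (fontaineTheta (integerC F) p)}
  {hψ : ∀ c, algebraMap (LTCoeff F) F (ψ c) = EisensteinRoot.CoeffDisc.toF D c}

variable (hθ hψ) in
/-- **The ω-period as a homomorphism `T_pŴ♭(𝒪_{ℂ_F}) →+ B_dR⁺(F)`, `τ ↦ ∫_τ ω = log_W(ι_𝒪[τ])`**, `W♭ = W ⊗_ψ 𝒪_F`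
(additive by `omegaPeriod_addSeq` over `A_inf(𝒪)`). [cite: Fontaine1982FormesDifferentielles, §5] -/
def omegaPeriodHomO : AinfTop.TatePtO F (W.map ψ) p →+ BdRPlusTop F p :=
  AddMonoidHom.mk' (fun τ => omegaPeriodO W ψ hθ hψ τ) fun τ τ' => by
    rw [omegaPeriodO_def, omegaPeriodO_def, omegaPeriodO_def]
    exact (omegaPeriod_congr_seq W (seqO_add_eq_addSeq W ψ hψ τ τ') _ _
      (coe_addSeq_zero W (AinfTop.seqO_zero _ τ) (AinfTop.seqO_zero _ τ'))
      (mulPC_addSeq W (mulPC_seqO W ψ hψ τ) (mulPC_seqO W ψ hψ τ'))).trans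
      (omegaPeriod_addSeq W (hθ := hθ) (AinfTop.seqO_zero _ τ) (AinfTop.seqO_zero _ τ') (mulPC_seqO W ψ hψ τ)
        (mulPC_seqO W ψ hψ τ'))

/-- Unfolding `omegaPeriodHomO`. [cite: Fontaine1982FormesDifferentielles, §5] -/
theorem omegaPeriodHomO_apply (τ : AinfTop.TatePtO F (W.map ψ) p) :
    omegaPeriodHomO W ψ hθ hψ τ = omegaPeriodO W ψ hθ hψ τ := rfl

/-- Unfolding `omegaPeriodHomO` down to the sequence-level `omegaPeriod`. [cite: Fontaine1982FormesDifferentielles, §5] -/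
theorem omegaPeriodHomO_apply' (τ : AinfTop.TatePtO F (W.map ψ) p) :
    omegaPeriodHomO W ψ hθ hψ τ =
      omegaPeriod W hθ (AinfTop.seqO (W.map ψ) τ) (AinfTop.seqO_zero _ τ) (mulPC_seqO W ψ hψ τ) := rfl

/-- **`∫_τ ω ∈ Fil¹ B_dR⁺`.** [cite: Fontaine1982FormesDifferentielles, §5] -/
theorem omegaPeriodHomO_mem_filOne (τ : AinfTop.TatePtO F (W.map ψ) p) :
    omegaPeriodHomO W ψ hθ hψ τ ∈ (BdRPlusTop.filOne F p).toIdeal :=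
  omegaPeriodO_mem_filOne W ψ hψ τ

/-- **`Γ_F`-equivariance of the ω-period: `σ(∫_τ ω) = ∫_{σ•τ} ω`.** [cite: Fontaine1982FormesDifferentielles, §5]
[cite: FontaineAsterisque223III, Exp. II §1.5.4] -/
theorem gal_omegaPeriodHomO (σ : absoluteGaloisGroup F) (τ : AinfTop.TatePtO F (W.map ψ) p) :
    BdRPlusTop.gal F p σ (omegaPeriodHomO W ψ hθ hψ τ) = omegaPeriodHomO W ψ hθ hψ (σ • τ) :=
  gal_omegaPeriodO W ψ hψ σ τ

/-- The same with the representation `tatePtORep`. [cite: Fontaine1982FormesDifferentielles, §5] -/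
theorem gal_omegaPeriodHomO' (σ : absoluteGaloisGroup F) (τ : AinfTop.TatePtO F (W.map ψ) p) :
    BdRPlusTop.gal F p σ (omegaPeriodHomO W ψ hθ hψ τ) = omegaPeriodHomO W ψ hθ hψ (AinfTop.tatePtORep F (W.map ψ) p σ τ) := by
  rw [AinfTop.tatePtORep_apply_apply]; exact gal_omegaPeriodO W ψ hψ σ τ

/-- **The ω-period is `ℤ`-linear**: `∫_{n•τ} ω = n • ∫_τ ω`. [cite: Fontaine1982FormesDifferentielles, §5] -/
theorem omegaPeriodHomO_zsmul (n : ℤ) (τ : AinfTop.TatePtO F (W.map ψ) p) :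
    omegaPeriodHomO W ψ hθ hψ (n • τ) = n • omegaPeriodHomO W ψ hθ hψ τ :=
  map_zsmul _ n τ

/-- `θ_dR(∫_τ ω) = 0`. [cite: FontaineAsterisque223III, Exp. II §1.5.2] -/
theorem thetaBdR_omegaPeriodHomO (τ : AinfTop.TatePtO F (W.map ψ) p) :
    thetaBdR ((BdRPlusTop.of F p).symm (omegaPeriodHomO W ψ hθ hψ τ)) = 0 :=
  thetaBdR_omegaPeriodO W ψ hψ τ

/-- **`k!·∫_τ ω ∈ ι_𝒪(A_inf(𝒪)) + Fil^k B_dR⁺`** uniformly in `τ` (`omegaPeriod_bounded` read on `TatePtO`).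
[cite: FontaineAsterisque223III, Exp. II §1.5.3] -/
theorem omegaPeriodHomO_bounded (k : ℕ) (τ : AinfTop.TatePtO F (W.map ψ) p) :
    ∃ (b : AinfRam D) (w : BdRPlusTop F p),
      ((k.factorial : ℤ) : BdRPlusTop F p) * omegaPeriodHomO W ψ hθ hψ τ =
        BdRPlusTop.of F p (AinfRam.toBdR D hθ b) + BdRPlusTop.of F p xiBdR ^ k * w :=
  omegaPeriod_bounded W k (AinfTop.seqO_zero _ τ) (mulPC_seqO W ψ hψ τ)

/-- **`ℤ_p`-linearity of the ω-period over the ramified base: `∫_{a•τ} ω = ι(a)·∫_τ ω`** (`a ∈ ℤ_p`; bounded additive maps into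
`B_dR⁺` are `ℤ_p`-linear, `AinfRam.map_smul_eq_of_bounded`). [cite: Colmez1992PeriodesAbeliennes, §2]
[cite: FontaineAsterisque223III, Exp. II §1.5.4] -/
theorem omegaPeriodHomO_smul (a : ℤ_[p]) (τ : AinfTop.TatePtO F (W.map ψ) p) :
    omegaPeriodHomO W ψ hθ hψ (a • τ) = BdRPlusTop.ofAinf F p (zpToAinf a) * omegaPeriodHomO W ψ hθ hψ τ :=
  AinfRam.map_smul_eq_of_bounded D hθ (omegaPeriodHomO W ψ hθ hψ)
    (fun k => ⟨(k.factorial : ℤ), by exact_mod_cast k.factorial_ne_zero, fun τ' => omegaPeriodHomO_bounded W ψ k τ'⟩) a τ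

/-- The same with the scalar read through `ℚ_p → B_dR⁺` (tree `qpToBdR`) — the hypothesis `hφ₁s` of the socket
`isDeRham_rationalTateRep_curveFO_of_periodHoms`. [cite: Colmez1992PeriodesAbeliennes, §2] -/
theorem omegaPeriodHomO_smul' (a : ℤ_[p]) (τ : AinfTop.TatePtO F (W.map ψ) p) :
    omegaPeriodHomO W ψ hθ hψ (a • τ) = BdRPlusTop.of F p (qpToBdR (a : ℚ_[p])) * omegaPeriodHomO W ψ hθ hψ τ := by
  rw [omegaPeriodHomO_smul, qpToBdR_coe]
  rfl

/-- `∫_τ ω ≠ 0` iff the sequence-level period of `seqO τ` is nonzero (bookkeeping for the non-vanishing witnesses (N1′) of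
`AinfRamifiedOmegaPeriodNonvanishingVarpi`). [cite: Fontaine1982FormesDifferentielles, §5] -/
theorem omegaPeriodHomO_ne_zero_iff (τ : AinfTop.TatePtO F (W.map ψ) p) :
    omegaPeriodHomO W ψ hθ hψ τ ≠ 0 ↔
      omegaPeriod W hθ (AinfTop.seqO (W.map ψ) τ) (AinfTop.seqO_zero _ τ) (mulPC_seqO W ψ hψ τ) ≠ 0 :=
  Iff.rfl

/-- **(N1′) read on `TatePtO`**: if the sequence-level ω-period is nonzero at every `[p]`-compatible `t` with `t₀ = 0`, `t₁ ≠ 0`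
(e.g. `omegaPeriod_ne_zero_of_varpi_shape` for the K★ cell models), then any `τ ∈ T_pŴ♭(𝒪_{ℂ_F})` with `τ₁ ≠ 0` has `∫_τ ω ≠ 0`.
[cite: Fontaine1982FormesDifferentielles, §5] -/
theorem exists_omegaPeriodHomO_ne_zero
    (hN1 : ∀ {t : ℕ → (maxNilIdealC F).toIdeal} (ht0 : (t 0 : CBall F) = 0) (htp : ∀ n, mulPC W (t (n + 1)) = t n),
      (t 1 : CBall F) ≠ 0 → omegaPeriod W hθ t ht0 htp ≠ 0)
    (hτ : ∃ τ : AinfTop.TatePtO F (W.map ψ) p,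
      ((((TateModule.proj p 1 τ).val : (maxNilIdealC F).toIdeal) : CBall F) : CompletedAlgClosure F) ≠ 0) :
    ∃ τ : AinfTop.TatePtO F (W.map ψ) p, omegaPeriodHomO W ψ hθ hψ τ ≠ 0 := by
  obtain ⟨τ, h1⟩ := hτ
  refine ⟨τ, (omegaPeriodHomO_ne_zero_iff W ψ τ).2 (hN1 _ _ fun h0 => h1 ?_)⟩
  rw [AinfTop.seqO_apply] at h0
  rw [h0]
  rfl

end AinfRamTop

end Literature.NumberTheory.PAdicHodge

end
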